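import Summits.Ventures.AbcSig.Rows.Bridge
import Summits.Ventures.AbcSig.Rows.C2aL67A0V2
import Summits.Ventures.AbcSig.Rows.C2aL67A0V2AB

/-!
# Venture AbcSig — CELL `C2aL67A0V2`: the census statement `Rows.C2aCellRed 67 (fun a => a = 0) {11, 13}` from the two row theorems

HONEST FRAMING. COMPUTATION cell `pub-abcsig`; CONDITIONAL theorem; no claim on ABC or any summit. Hypotheses exactly as in
`Rows/C2aL67A0V2.lean` and `Rows/C2aL67A0V2AB.lean`: `BS04Package` (CITED), `DataComplete` / `RefinesCPSymAll` (COMPUTED, certified level files;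
norm-form certificates), `EisPackage` (CITED) + `Refines` (COMPUTED) for the kernel M6 discharges, and the rows' per-orbit CITED exclusions universally quantified in the exponent
(shared by both distributions (a = 0: the second is the first with x, y swapped)). Conclusion = p1's census predicate (`Rows/Statements.lean`) with the residual of the row of
record `census/rows/T-BS13/C2a-l67-a0.md` (sha16 `2054a4783809b301`): all four coprime distributions `A·B = 2^0·67^m`, reduced exponents.
GENERATED by p-lean g4 `gen4/c2arow2.py` (pattern of `Rows/C2aL277A0XCell.lean`).
-/

namespace Summit.Ventures.AbcSig

/-- Cell `C2aL67A0V2`: `Rows.C2aCellRed 67 (fun a => a = 0) {11, 13}` under the rows' hypotheses. -/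
theorem xcell_C2aL67A0V2 (M : NewformModel) (hP : M.BS04Package)
    (hE : M.EisPackage)
    (hR_orbit_134_1 : M.Refines 134 orbit_134_1 m6X_134_1)
    (hD2144 : M.DataComplete 2144 level2144Orbits)
    (hD134 : M.DataComplete 134 level134Orbits)
    (hX_orbit_2144_5 : ∀ n m : ℕ, n ∈ ([17] : List ℕ) → M.Excludes 2144 orbit_2144_5 (famB (2 ^ 0 * 67 ^ m) n (fun _ _ => True)))
    (hX_orbit_2144_6 : ∀ n m : ℕ, n ∈ ([17] : List ℕ) → M.Excludes 2144 orbit_2144_6 (famB (2 ^ 0 * 67 ^ m) n (fun _ _ => True))) :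
    Rows.C2aCellRed 67 (fun a => a = 0) {11, 13} :=
  C2aCellRed_of_rows 67 (by norm_num) (by norm_num) _ _
    (fun n hn h11 hnℓ hR a m (ha : a = 0) han hm hmn x y z h1 h2 => by
      subst ha
      exact xrow_C2aL67A0V2 M hP hE hR_orbit_134_1 hD2144 hD134 n hn h11 hnℓ (by simpa using hR) m hm hmn (hX_orbit_2144_5 n m) (hX_orbit_2144_6 n m) x y z h1 h2)
    (fun n hn h11 hnℓ hR a m (ha : a = 0) han hm hmn x y z h1 h2 => by
      subst ha
      exact xrow_C2aL67A0V2AB M hP hE hR_orbit_134_1 hD2144 hD134 n hn h11 hnℓ (by simpa using hR) m hm hmn (hX_orbit_2144_5 n m) (hX_orbit_2144_6 n m) x y z h1 h2)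

end Summit.Ventures.AbcSig
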